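import Summits.Ventures.CertifiedManyBodySolver.Downfold.EmeryFermiSurfaceScaleSign
import HarnessLib

/-!
# The Cu-d WEIGHT of the σ three-band antibonding Bloch state in closed form — `w_d = M_dd/∂_ε P` on the
# energy-ε contour — and the ONE-BODY statement behind «INFL-3to1 by sign of doping»

Venture CertifiedManyBodySolver, cell `pub/hubbard-downfold` (stage S1 = ROUTER; technique B = band level), seat
hubbard-downfold-mod-4; namespace `Summit.Ventures.CertifiedManyBodySolver.Downfold.Emery`. Sequel of
`EmeryFermiSurfaceShape` (`charCubic`, the secular cubic of `bloch4` in `x = sin²(k_x/2)`, `y = sin²(k_y/2)`),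
`EmeryFermiSurfaceShapeBox` §2 (`dcharCubic = ∂_ε charCubic`), `EmeryAntibondingBand` (`abBand` = the top root) and
`EmeryFermiSurfaceScaleSign` (`dcharCubic_abBand_nonneg`).

THE QUESTION (cell bus 2026-08-27T11:37:58Z, lit-1 REFVALS-1 §C17 «INFL-3to1 by SIGN of doping»: in the correlated (mVMC)
solution of the MACE three-band Hamiltonians doped HOLES sit 84–97 % on O-2pσ and leave the bonding band by 7–8 %, doped
ELECTRONS sit 77–109 % on Cu-d and enter the antibonding band to 100 %). What does the ONE-BODY band reduction say? Two exact
statements, both elementary algebra on the 3 × 3 Bloch matrix `H = bloch4 Δ t_pd t_pp c sx sy` (basis `d, p_x, p_y`; `ε_d = 0`,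
`ε_p = −Δ − 4c·s²`):

* §1 the three PRINCIPAL 2 × 2 MINORS `minorD`, `minorX`, `minorY` of `H − ε` (delete the `d`, `p_x`, `p_y` row and column) and the
  identity `minorD + minorX + minorY = dcharCubic` (`sum_minors_eq_dcharCubic`: the energy derivative of the secular cubic is the
  trace of the adjugate — pure `ring`); the three COFACTOR EXPANSIONS of `charCubic = −det(H − ε)` along the `d`, `p_x`, `p_y` rows
  (`charCubic_expand_d/x/y`), each of the form `(ε − level)·minor − (manifestly signed terms)`;
* §2 SIGNS ON THE ANTIBONDING SHEET: for `Δ ≥ 0`, `c ≥ 0`, `t_pp ≥ 0`, `x, y ∈ [0, 1]` and `ε = abBand(x, y)` (the top root) with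
  `ε > 0`: `minorD ≥ 0`, `minorX ≥ 0`, `minorY ≥ 0` (from the expansions: `ε·minorD`, `(ε + Δ + 4cx)·minorX`, `(ε + Δ + 4cy)·minorY`
  are sums of non-negative terms on the contour) — Cauchy interlacing for this matrix without spectral theory;
* §3 THE d-WEIGHT: `dWeight := minorD/(minorD + minorX + minorY)`; the first adjugate column `adjCol = (minorD, cofXD, cofYD)` is
  a null vector of `H − ε` on the contour (`bloch4_mulVec_adjCol`: `(H − ε)·adjCol = −charCubic·e_d`, so `= 0` when
  `charCubic = 0`), and its squared norm is `minorD·(minorD + minorX + minorY) − charCubic·(2ε + 2Δ + 4c(x + y))`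
  (`adjCol_normSq`, Jacobi's complementary-minor identity, pure `ring`) — hence ON THE CONTOUR the normalised Cu-d weight of
  that eigenvector, `adjCol_d²/‖adjCol‖²`, EQUALS `dWeight` whenever `minorD ≠ 0` (`dWeight_eq_component_ratio`), and
  `0 ≤ dWeight ≤ 1` on the antibonding sheet (`dWeight_nonneg`, `dWeight_le_one`); `dWeight = minorD/dcharCubic`
  (`dWeight_eq_div_dcharCubic`) ties it to the scale denominator of `EmeryFermiSurfaceShapeBox.scaleT`;
* §4 BY SIGN, AT ONE BODY: doped carriers of either sign are antibonding-band Bloch states (the band share dropped by a one-band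
  image is 0 at one body for BOTH signs — the 7–8 % bonding-band share of doped holes in §C17 is entirely a correlation effect),
  and their Cu-d share is `dWeight` at the Fermi contour; the pure statement typed here is the MONOTONICITY that orders the two
  signs at one body: on the zone axis (`y = 0`, `c = 0`) the three-band d-weight reduces to the two-level form
  (`dWeight_axis`: `dWeight·(2ε + Δ) = ε + Δ` on the axis contour), and for the GENERIC two-level (d above the coupled p
  combination by `D ≥ 0`, coupling `V`) problem the upper state's d-weight `twoLevelDWeight D V = (1 + D/√(D² + 4V²))/2` lies in
  `[1/2, 1]` (`half_le_twoLevelDWeight`, `twoLevelDWeight_le_one`) and is NON-INCREASING in `|V|` (`twoLevelDWeight_anti`) — the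
  coupling and the energy grow together along the antibonding band, so the doped-HOLE states (lower `ε`) are at least as d-like
  as the doped-ELECTRON states (higher `ε`); this is the statement the numerics of
  router/TECHNIQUE-B-ROWS v1.8 instantiate (kit j277953: one-body Cu-d share of doped holes EXCEEDS that of doped electrons
  by +0.014…+0.022 at δ = 0.10 and +0.030…+0.048 at δ = 0.219 on every cuprate/nickelate set, both in 0.54–0.83 (cuprates 0.54–0.78):
  the OPPOSITE ordering to, and far from, the correlated occupations of §C17 (holes 3–30 % d, electrons 77–109 % d) —
  INFLATION-RULES-3to1-B §B.23).

Everything here is PROVED (0 sorry; elementary algebra and one square-root monotonicity). HONEST FRAMING: one-body statements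
about the σ model AS PRINTED; nothing about correlations (the §C17 numbers are the correlated answer this file does NOT reproduce —
that gap is the located size of what U does to the carrier character); no material is certified by this file.
-/

namespace Summit.Ventures.CertifiedManyBodySolver.Downfold.Emery

open Matrix

noncomputable section

/-! ## §1 Principal minors, cofactor expansions, and the trace-of-adjugate identity -/

/-- Principal 2 × 2 minor of `bloch4 − ε` deleting the `d` row/column (the `p_x, p_y` block):
`(−Δ − 4cx − ε)(−Δ − 4cy − ε) − 16 t_pp² x y` with `x = sx²`, `y = sy²`. [folklore] -/
def minorD (Δ tpp c x y ε : ℝ) : ℝ := (-Δ - 4 * c * x - ε) * (-Δ - 4 * c * y - ε) - 16 * tpp ^ 2 * x * y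

/-- Principal minor deleting the `p_x` row/column (the `d, p_y` block): `(−ε)(−Δ − 4cy − ε) − 4 t_pd² y`. [folklore] -/
def minorX (Δ tpd c y ε : ℝ) : ℝ := (-ε) * (-Δ - 4 * c * y - ε) - 4 * tpd ^ 2 * y

/-- Principal minor deleting the `p_y` row/column (the `d, p_x` block): `(−ε)(−Δ − 4cx − ε) − 4 t_pd² x`. [folklore] -/
def minorY (Δ tpd c x ε : ℝ) : ℝ := (-ε) * (-Δ - 4 * c * x - ε) - 4 * tpd ^ 2 * x

/-- **Trace of the adjugate = energy derivative of the secular cubic**: `minorD + minorX + minorY = dcharCubic`. [folklore] -/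
theorem sum_minors_eq_dcharCubic (Δ tpd tpp c x y ε : ℝ) :
    minorD Δ tpp c x y ε + minorX Δ tpd c y ε + minorY Δ tpd c x ε = dcharCubic Δ tpd tpp c x y ε := by
  unfold minorD minorX minorY dcharCubic dcA dfsD dfsN
  ring

/-- **Cofactor expansion along the `d` row**: `charCubic = ε·minorD − 4t_pd²[x(Δ + 4cy + ε) + y(Δ + 4cx + ε)] − 32 t_pd² t_pp x y`,
i.e. on the contour `ε·minorD = 4t_pd²[x(Δ + 4cy + ε) + y(Δ + 4cx + ε)] + 32 t_pd² t_pp x y`. [folklore] -/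
theorem charCubic_expand_d (Δ tpd tpp c x y ε : ℝ) :
    charCubic Δ tpd tpp c x y ε =
      ε * minorD Δ tpp c x y ε - 4 * tpd ^ 2 * (x * (Δ + 4 * c * y + ε) + y * (Δ + 4 * c * x + ε))
        - 32 * tpd ^ 2 * tpp * x * y := by
  unfold charCubic minorD
  ring

/-- **Cofactor expansion along the `p_x` row**: `charCubic = (ε + Δ + 4cx)·minorX − 4t_pd² x (ε + Δ + 4cy) − 16 t_pp² x y ε
− 32 t_pd² t_pp x y`. [folklore] -/
theorem charCubic_expand_x (Δ tpd tpp c x y ε : ℝ) :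
    charCubic Δ tpd tpp c x y ε =
      (ε + Δ + 4 * c * x) * minorX Δ tpd c y ε - 4 * tpd ^ 2 * x * (ε + Δ + 4 * c * y) - 16 * tpp ^ 2 * x * y * ε
        - 32 * tpd ^ 2 * tpp * x * y := by
  unfold charCubic minorX
  ring

/-- **Cofactor expansion along the `p_y` row** (mirror of `charCubic_expand_x`). [folklore] -/
theorem charCubic_expand_y (Δ tpd tpp c x y ε : ℝ) :
    charCubic Δ tpd tpp c x y ε =
      (ε + Δ + 4 * c * y) * minorY Δ tpd c x ε - 4 * tpd ^ 2 * y * (ε + Δ + 4 * c * x) - 16 * tpp ^ 2 * x * y * ε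
        - 32 * tpd ^ 2 * tpp * x * y := by
  unfold charCubic minorY
  ring

/-! ## §2 Signs of the minors on the antibonding sheet (interlacing without spectral theory) -/

/-- On a contour point with `ε > 0`, `Δ ≥ 0`, `c, t_pp ≥ 0`, `x, y ≥ 0`: **`minorD ≥ 0`**. [folklore] -/
theorem minorD_nonneg_of_contour {Δ tpd tpp c x y ε : ℝ} (hΔ : 0 ≤ Δ) (hc : 0 ≤ c) (htpp : 0 ≤ tpp) (hx : 0 ≤ x) (hy : 0 ≤ y)
    (hε : 0 < ε) (hP : charCubic Δ tpd tpp c x y ε = 0) : 0 ≤ minorD Δ tpp c x y ε := by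
  have h := charCubic_expand_d Δ tpd tpp c x y ε
  rw [hP] at h
  have hprod : 0 ≤ ε * minorD Δ tpp c x y ε := by
    have h1 : 0 ≤ 4 * tpd ^ 2 * (x * (Δ + 4 * c * y + ε) + y * (Δ + 4 * c * x + ε)) := by positivity
    have h2 : 0 ≤ 32 * tpd ^ 2 * tpp * x * y := by positivity
    linarith
  exact nonneg_of_mul_nonneg_right (by simpa [mul_comm] using hprod) hε

/-- On a contour point with `ε > 0`, `Δ ≥ 0`, `c, t_pp ≥ 0`, `x, y ≥ 0`: **`minorX ≥ 0`**. [folklore] -/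
theorem minorX_nonneg_of_contour {Δ tpd tpp c x y ε : ℝ} (hΔ : 0 ≤ Δ) (hc : 0 ≤ c) (htpp : 0 ≤ tpp) (hx : 0 ≤ x) (hy : 0 ≤ y)
    (hε : 0 < ε) (hP : charCubic Δ tpd tpp c x y ε = 0) : 0 ≤ minorX Δ tpd c y ε := by
  have h := charCubic_expand_x Δ tpd tpp c x y ε
  rw [hP] at h
  have hlev : 0 < ε + Δ + 4 * c * x := by positivity
  have hprod : 0 ≤ (ε + Δ + 4 * c * x) * minorX Δ tpd c y ε := by
    have h1 : 0 ≤ 4 * tpd ^ 2 * x * (ε + Δ + 4 * c * y) := by positivity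
    have h2 : 0 ≤ 16 * tpp ^ 2 * x * y * ε := by positivity
    have h3 : 0 ≤ 32 * tpd ^ 2 * tpp * x * y := by positivity
    linarith
  exact nonneg_of_mul_nonneg_right (by simpa [mul_comm] using hprod) hlev

/-- On a contour point with `ε > 0`, `Δ ≥ 0`, `c, t_pp ≥ 0`, `x, y ≥ 0`: **`minorY ≥ 0`**. [folklore] -/
theorem minorY_nonneg_of_contour {Δ tpd tpp c x y ε : ℝ} (hΔ : 0 ≤ Δ) (hc : 0 ≤ c) (htpp : 0 ≤ tpp) (hx : 0 ≤ x) (hy : 0 ≤ y)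
    (hε : 0 < ε) (hP : charCubic Δ tpd tpp c x y ε = 0) : 0 ≤ minorY Δ tpd c x ε := by
  have h := charCubic_expand_y Δ tpd tpp c x y ε
  rw [hP] at h
  have hlev : 0 < ε + Δ + 4 * c * y := by positivity
  have hprod : 0 ≤ (ε + Δ + 4 * c * y) * minorY Δ tpd c x ε := by
    have h1 : 0 ≤ 4 * tpd ^ 2 * y * (ε + Δ + 4 * c * x) := by positivity
    have h2 : 0 ≤ 16 * tpp ^ 2 * x * y * ε := by positivity
    have h3 : 0 ≤ 32 * tpd ^ 2 * tpp * x * y := by positivity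
    linarith
  exact nonneg_of_mul_nonneg_right (by simpa [mul_comm] using hprod) hlev

/-- The antibonding band is a contour point: `charCubic(abBand) = 0` (re-export for use below). [folklore] -/
theorem charCubic_abBand' (Δ tpd tpp c x y : ℝ) : charCubic Δ tpd tpp c x y (abBand Δ tpd tpp c x y) = 0 :=
  charCubic_abBand Δ tpd tpp c x y

/-- **`abBand ≥ 0` for `Δ ≥ 0`, `c, t_pp ≥ 0`, `x, y ≥ 0`** (the cubic is `≤ 0` at `ε = 0`: `charCubic(0) = −4t_pd²(xΔ_y + yΔ_x)
− 32t_pd²t_pp xy ≤ 0`). [folklore] -/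
theorem abBand_nonneg {Δ tpd tpp c x y : ℝ} (hΔ : 0 ≤ Δ) (hc : 0 ≤ c) (htpp : 0 ≤ tpp) (hx : 0 ≤ x) (hy : 0 ≤ y) :
    0 ≤ abBand Δ tpd tpp c x y := by
  apply le_abBand_of_charCubic_nonpos
  have h1 : 0 ≤ 4 * tpd ^ 2 * (x * (Δ + 4 * c * y + 0) + y * (Δ + 4 * c * x + 0)) := by positivity
  have h2 : 0 ≤ 32 * tpd ^ 2 * tpp * x * y := by positivity
  rw [charCubic_expand_d]
  simp only [zero_mul, zero_sub]
  linarith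

/-! ## §3 The Cu-d weight of the antibonding Bloch state -/

/-- **The Cu-d weight function** `w_d(ε; x, y) = minorD/(minorD + minorX + minorY)` — on the energy-`ε` contour it IS the
normalised `|ψ_d|²` of the Bloch eigenvector (`dWeight_eq_component_ratio`), and `= ∂E/∂ε_d` by Hellmann–Feynman (prose).
[folklore] -/
def dWeight (Δ tpd tpp c x y ε : ℝ) : ℝ :=
  minorD Δ tpp c x y ε / (minorD Δ tpp c x y ε + minorX Δ tpd c y ε + minorY Δ tpd c x ε)

/-- `dWeight = minorD/dcharCubic`. [folklore] -/
theorem dWeight_eq_div_dcharCubic (Δ tpd tpp c x y ε : ℝ) :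
    dWeight Δ tpd tpp c x y ε = minorD Δ tpp c x y ε / dcharCubic Δ tpd tpp c x y ε := by
  rw [dWeight, sum_minors_eq_dcharCubic]

/-- Off-diagonal cofactor `(x, d)` of `bloch4 − ε` (sign included): `−[2t_pd sx·(−Δ − 4c y − ε) − (−2t_pd sy)(−4t_pp sx sy)]`.
[folklore] -/
def cofXD (Δ tpd tpp c sx sy ε : ℝ) : ℝ :=
  -(2 * tpd * sx * (-Δ - 4 * c * sy ^ 2 - ε) - (-2 * tpd * sy) * (-4 * tpp * sx * sy))

/-- Off-diagonal cofactor `(y, d)` of `bloch4 − ε`: `2t_pd sx·(−4t_pp sx sy) − (−2t_pd sy)(−Δ − 4c x − ε)`. [folklore] -/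
def cofYD (Δ tpd tpp c sx sy ε : ℝ) : ℝ :=
  2 * tpd * sx * (-4 * tpp * sx * sy) - (-2 * tpd * sy) * (-Δ - 4 * c * sx ^ 2 - ε)

/-- **The first adjugate column of `bloch4 − ε`**, `(minorD, cofXD, cofYD)`. [folklore] -/
def adjCol (Δ tpd tpp c sx sy ε : ℝ) : Fin 3 → ℝ :=
  ![minorD Δ tpp c (sx ^ 2) (sy ^ 2) ε, cofXD Δ tpd tpp c sx sy ε, cofYD Δ tpd tpp c sx sy ε]

/-- **`(H − ε)·adjCol = −charCubic · e_d`**: the adjugate column is an eigenvector candidate whose defect is the secular cubic.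
[folklore] -/
theorem bloch4_mulVec_adjCol (Δ tpd tpp c sx sy ε : ℝ) :
    (bloch4 Δ tpd tpp c sx sy - ε • (1 : Matrix (Fin 3) (Fin 3) ℝ)) *ᵥ adjCol Δ tpd tpp c sx sy ε =
      ![-charCubic Δ tpd tpp c (sx ^ 2) (sy ^ 2) ε, 0, 0] := by
  ext i
  fin_cases i <;>
    simp [bloch4, adjCol, minorD, cofXD, cofYD, charCubic, Matrix.mulVec, dotProduct, Fin.sum_univ_three,
      Matrix.sub_apply, Matrix.smul_apply, Matrix.one_apply] <;> ring

/-- **ON THE CONTOUR the adjugate column is a null vector of `H − ε`** (an eigenvector of `H` with eigenvalue `ε` when non-zero).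
[folklore] -/
theorem bloch4_mulVec_adjCol_eq_zero {Δ tpd tpp c sx sy ε : ℝ} (hP : charCubic Δ tpd tpp c (sx ^ 2) (sy ^ 2) ε = 0) :
    (bloch4 Δ tpd tpp c sx sy - ε • (1 : Matrix (Fin 3) (Fin 3) ℝ)) *ᵥ adjCol Δ tpd tpp c sx sy ε = 0 := by
  rw [bloch4_mulVec_adjCol, hP, neg_zero]
  ext i; fin_cases i <;> simp

/-- **Jacobi's complementary-minor identity for this matrix**: `‖adjCol‖² = minorD·(minorD + minorX + minorY)
− charCubic·(2ε + 2Δ + 4c(sx² + sy²))` — so on the contour `‖adjCol‖² = minorD · ∂_ε charCubic`. [folklore] -/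
theorem adjCol_normSq (Δ tpd tpp c sx sy ε : ℝ) :
    minorD Δ tpp c (sx ^ 2) (sy ^ 2) ε ^ 2 + cofXD Δ tpd tpp c sx sy ε ^ 2 + cofYD Δ tpd tpp c sx sy ε ^ 2 =
      minorD Δ tpp c (sx ^ 2) (sy ^ 2) ε *
          (minorD Δ tpp c (sx ^ 2) (sy ^ 2) ε + minorX Δ tpd c (sy ^ 2) ε + minorY Δ tpd c (sx ^ 2) ε)
        - charCubic Δ tpd tpp c (sx ^ 2) (sy ^ 2) ε * (2 * ε + 2 * Δ + 4 * c * (sx ^ 2 + sy ^ 2)) := by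
  unfold minorD minorX minorY cofXD cofYD charCubic
  ring

/-- **The Cu-d weight of the contour eigenvector equals `dWeight`**: if `charCubic = 0` and `minorD ≠ 0` then
`adjCol_d² / ‖adjCol‖² = dWeight`. [folklore] -/
theorem dWeight_eq_component_ratio {Δ tpd tpp c sx sy ε : ℝ} (hP : charCubic Δ tpd tpp c (sx ^ 2) (sy ^ 2) ε = 0)
    (hD : minorD Δ tpp c (sx ^ 2) (sy ^ 2) ε ≠ 0) :
    minorD Δ tpp c (sx ^ 2) (sy ^ 2) ε ^ 2 /
        (minorD Δ tpp c (sx ^ 2) (sy ^ 2) ε ^ 2 + cofXD Δ tpd tpp c sx sy ε ^ 2 + cofYD Δ tpd tpp c sx sy ε ^ 2) =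
      dWeight Δ tpd tpp c (sx ^ 2) (sy ^ 2) ε := by
  rw [adjCol_normSq, hP, zero_mul, sub_zero, dWeight, pow_two, mul_div_mul_left _ _ hD]

/-- **`0 ≤ dWeight` on the antibonding sheet** (`Δ ≥ 0`, `c, t_pp ≥ 0`, `x, y ≥ 0`, `ε = abBand > 0`). [folklore] -/
theorem dWeight_nonneg {Δ tpd tpp c x y : ℝ} (hΔ : 0 ≤ Δ) (hc : 0 ≤ c) (htpp : 0 ≤ tpp) (hx : 0 ≤ x) (hy : 0 ≤ y)
    (hε : 0 < abBand Δ tpd tpp c x y) : 0 ≤ dWeight Δ tpd tpp c x y (abBand Δ tpd tpp c x y) := by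
  have hP := charCubic_abBand' Δ tpd tpp c x y
  have hD := minorD_nonneg_of_contour hΔ hc htpp hx hy hε hP
  have hX := minorX_nonneg_of_contour hΔ hc htpp hx hy hε hP
  have hY := minorY_nonneg_of_contour hΔ hc htpp hx hy hε hP
  unfold dWeight
  positivity

/-- **`dWeight ≤ 1` on the antibonding sheet.** [folklore] -/
theorem dWeight_le_one {Δ tpd tpp c x y : ℝ} (hΔ : 0 ≤ Δ) (hc : 0 ≤ c) (htpp : 0 ≤ tpp) (hx : 0 ≤ x) (hy : 0 ≤ y)
    (hε : 0 < abBand Δ tpd tpp c x y) : dWeight Δ tpd tpp c x y (abBand Δ tpd tpp c x y) ≤ 1 := by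
  have hP := charCubic_abBand' Δ tpd tpp c x y
  have hD := minorD_nonneg_of_contour hΔ hc htpp hx hy hε hP
  have hX := minorX_nonneg_of_contour hΔ hc htpp hx hy hε hP
  have hY := minorY_nonneg_of_contour hΔ hc htpp hx hy hε hP
  unfold dWeight
  rcases eq_or_lt_of_le (add_nonneg (add_nonneg hD hX) hY) with h0 | hpos
  · rw [← h0, div_zero]; exact zero_le_one
  · rw [div_le_one hpos]; linarith

/-- **The p-weight is the complement**: `1 − dWeight = (minorX + minorY)/(minorD + minorX + minorY)` whenever the denominator
is non-zero. [folklore] -/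
theorem one_sub_dWeight {Δ tpd tpp c x y ε : ℝ}
    (h : minorD Δ tpp c x y ε + minorX Δ tpd c y ε + minorY Δ tpd c x ε ≠ 0) :
    1 - dWeight Δ tpd tpp c x y ε =
      (minorX Δ tpd c y ε + minorY Δ tpd c x ε) / (minorD Δ tpp c x y ε + minorX Δ tpd c y ε + minorY Δ tpd c x ε) := by
  unfold dWeight
  field_simp
  ring

/-! ## §4 By sign, at one body: the two-level monotonicity that orders doped holes and electrons -/

/-- The d-weight of the UPPER state of a two-level problem `[[0, V], [V, −D]]` (d at `0`, the coupled p-combination at `−D ≤ 0`):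
`(1 + D/√(D² + 4V²))/2` (for `D = 0 = V` the formula reads `1/2`, immaterial). This is `dWeight` on the zone axis `y = 0`, `c = 0`
with `V² = 4t_pd² x` (the `p_y` orbital decouples). [folklore] -/
def twoLevelDWeight (D V : ℝ) : ℝ := (1 + D / Real.sqrt (D ^ 2 + 4 * V ^ 2)) / 2

/-- `twoLevelDWeight ≤ 1` for `D ≥ 0`. [folklore] -/
theorem twoLevelDWeight_le_one {D V : ℝ} (hD : 0 ≤ D) : twoLevelDWeight D V ≤ 1 := by
  unfold twoLevelDWeight
  have hs : D ≤ Real.sqrt (D ^ 2 + 4 * V ^ 2) := by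
    calc D = Real.sqrt (D ^ 2) := (Real.sqrt_sq hD).symm
      _ ≤ Real.sqrt (D ^ 2 + 4 * V ^ 2) := Real.sqrt_le_sqrt (by nlinarith [sq_nonneg V])
  rcases eq_or_lt_of_le (Real.sqrt_nonneg (D ^ 2 + 4 * V ^ 2)) with h0 | hpos
  · rw [← h0, div_zero]; norm_num
  · have : D / Real.sqrt (D ^ 2 + 4 * V ^ 2) ≤ 1 := by rw [div_le_one hpos]; exact hs
    linarith

/-- `1/2 ≤ twoLevelDWeight` for `D ≥ 0` (the upper state is at least half d-like when d lies above p). [folklore] -/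
theorem half_le_twoLevelDWeight {D V : ℝ} (hD : 0 ≤ D) : 1 / 2 ≤ twoLevelDWeight D V := by
  unfold twoLevelDWeight
  have : 0 ≤ D / Real.sqrt (D ^ 2 + 4 * V ^ 2) := div_nonneg hD (Real.sqrt_nonneg _)
  linarith

/-- **BY-SIGN ORDERING AT ONE BODY (two-level form)**: for `D ≥ 0` the upper state's d-weight is NON-INCREASING in the coupling
magnitude: `|V₁| ≤ |V₂| ⇒ twoLevelDWeight D V₂ ≤ twoLevelDWeight D V₁`. Along the antibonding band the coupling grows with
`x = sin²(k_x/2)` and so does the energy, so LOWER-energy antibonding states (where doped HOLES go) are at least as d-like as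
HIGHER-energy ones (where doped ELECTRONS go) — the opposite ordering to the correlated occupations of REFVALS-1 §C17. [folklore] -/
theorem twoLevelDWeight_anti {D V₁ V₂ : ℝ} (hD : 0 ≤ D) (hV : |V₁| ≤ |V₂|) :
    twoLevelDWeight D V₂ ≤ twoLevelDWeight D V₁ := by
  unfold twoLevelDWeight
  have hsq : V₁ ^ 2 ≤ V₂ ^ 2 := by
    rw [← sq_abs V₁, ← sq_abs V₂]; exact pow_le_pow_left₀ (abs_nonneg _) hV 2
  have h1 : Real.sqrt (D ^ 2 + 4 * V₁ ^ 2) ≤ Real.sqrt (D ^ 2 + 4 * V₂ ^ 2) := Real.sqrt_le_sqrt (by linarith)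
  rcases eq_or_lt_of_le hD with hD0 | hDpos
  · simp [← hD0]
  · have hpos1 : 0 < Real.sqrt (D ^ 2 + 4 * V₁ ^ 2) := Real.sqrt_pos.2 (by positivity)
    have : D / Real.sqrt (D ^ 2 + 4 * V₂ ^ 2) ≤ D / Real.sqrt (D ^ 2 + 4 * V₁ ^ 2) :=
      div_le_div_of_nonneg_left hD hpos1 h1
    linarith

/-- **On the zone axis `y = 0` with `c = 0` the three-band d-weight IS the two-level d-weight**: at a contour point
`ε > 0` of `charCubic Δ t_pd t_pp 0 x 0`, `dWeight = twoLevelDWeight Δ (2 t_pd √x)`-squared form, stated without square roots as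
`dWeight·(2ε + Δ) = ε + Δ` (from `minorD = (Δ + ε)²·… `; the axis secular relation `ε(ε + Δ) = 4t_pd² x`). [folklore] -/
theorem dWeight_axis {Δ tpd tpp x ε : ℝ} (hε : 0 < ε) (hΔ : 0 ≤ Δ) (hP : charCubic Δ tpd tpp 0 x 0 ε = 0) :
    dWeight Δ tpd tpp 0 x 0 ε * (2 * ε + Δ) = ε + Δ := by
  -- on the axis: charCubic = (Δ + ε)·[ε(Δ + ε) − 4 t_pd² x]
  have hsec : ε * (Δ + ε) = 4 * tpd ^ 2 * x := by
    have h := hP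
    unfold charCubic at h
    have hfac : (Δ + ε) * (ε * (Δ + ε) - 4 * tpd ^ 2 * x) = 0 := by nlinarith [h]
    rcases mul_eq_zero.1 hfac with h1 | h2
    · exfalso; linarith
    · linarith
  have hDε : 0 < Δ + ε := by linarith
  -- minorD = (Δ+ε)², minorX = ε(Δ+ε), minorY = ε(Δ+ε) − 4t²x = 0 on the axis contour
  have hS : minorD Δ tpp 0 x 0 ε + minorX Δ tpd 0 0 ε + minorY Δ tpd 0 x ε = (Δ + ε) * (Δ + 2 * ε) := by
    unfold minorD minorX minorY; linear_combination hsec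
  have hDm : minorD Δ tpp 0 x 0 ε = (Δ + ε) ^ 2 := by unfold minorD; ring
  unfold dWeight
  rw [hS, hDm]
  have hne : (Δ + ε) * (Δ + 2 * ε) ≠ 0 := by positivity
  field_simp
  ring

end

end Summit.Ventures.CertifiedManyBodySolver.Downfold.Emery
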